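import Literature.Probability.RandomPlanarGeometry.HexSAWStripELimZeroY
import Literature.Probability.RandomPlanarGeometry.HexSAWStripSurfaceZigzag
import Literature.Probability.RandomPlanarGeometry.HexSAWStripIdentityY
import Literature.Probability.RandomPlanarGeometry.HexSAWStripBlimPos
import HarnessLib

/-!
# The critical surface fugacity of honeycomb self-avoiding walks, DCS orientation: the strip-level core of `y_c = 1 + √2`
# (CAPSTONE-DCS ed.3 of door R96′ «HEX-YC-DCS» — ALL UNCONDITIONAL; a-idea-1 gen 17, HOME-only; successor train item ⑦)

Topic `Literature/Probability/RandomPlanarGeometry`.  Continues the HOME files of the lane «pub-sawmu» (to be filed before this one):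
a-p5 g7 `HexSAWStripSurfaceArchCut.lean` 573235f0 (the y-weighted strip vocabulary `HV.surfContacts`, `HV.stripGFy` and face Y2′
`HV.stripArchCut_holds : StripArchCut`), a-p2 g7 `HexSAWStripIdentityY.lean` ed.2 7dcd00ec (K97.1: `yStar`, `betaY`, face Y1′
`HV.stripIdentityY_holds : StripIdentityY`, the §4.2 lower half `HV.stripByBound_holds : StripByBound`, `stripGFy_beta_le`), a-p5 g7
`HexSAWStripBlimPos.lean` 2d1bc3dd (S0′ `HV.stripBlimPos_holds : StripBlimPos`), a-p5 g7 `HexSAWStripELimZeroY.lean` 492e9b8b (face Y3′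
`HV.StripELimZeroY` / `HV.stripELimZeroY_holds`, over `HexSAWStripEpsWalks` 4a6f1583 and `HexSAWStripPairsTransfer` 8f21a866), a-p2 g7
`HexSAWStripSurfaceZigzag.lean` a91cbe0d (face UB′ `HV.StripByUnboundedLarge` / `HV.stripByUnboundedLarge_holds`); and the TREE's `HexSAWStripIdentity.lean`
(`strip_identity_lim`, `stripElim_zero`), `HexSAWBridgeDecay.lean` (`tendsto_stripBlim`: `B_T(x_c) → 0`), `HexSAWLowerBound.lean`
(`stripBlim`, `stripA_le_lim`, `stripB_le_lim`), `HexSAWEscapeMass.lean` (`stripBlim_nonneg`).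

Source: N. R. Beaton, M. Bousquet-Mélou, J. de Gier, H. Duminil-Copin, A. J. Guttmann, *The critical fugacity for surface adsorption of
self-avoiding walks on the honeycomb lattice is 1 + √2*, Comm. Math. Phys. 326 (2014) 727–754, arXiv:1109.0358v5: THEOREM 2 (p. 3),
Proposition 4 = eq. (11) (p. 7), §4.1 eq. (16) (p. 13), §4.2 eq. (17) (p. 14), Proposition 9 = eq. (18) and Theorem 10 (p. 14), §4.5
eq. (20) (p. 15); Corollary 8 (p. 12) for the printed `y_T`.

## What is proved here (all glue; standard axioms)

* `stripByUnbounded_of_faces` / `stripByUnbounded_of_faces_c` — §4.5: Y1′ + Y2′ (+ its factor-`c` variant) + Y3′ + S0′ + the tree's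
  `strip_identity_lim` and `tendsto_stripBlim` give `StripByUnbounded`: for `y > y* = 1 + √2` and all large `T`, `L ↦ B_{T,L}(x_c; y)` is
  unbounded («y_T < y», the `y_c ≤ 1 + √2` half of Theorem 2 at strip level).
* **`hexYcDCSCore_holds : HexYcDCSCore` — both halves, UNCONDITIONAL**, the four faces discharged by name: Y1′ `stripIdentityY_holds`
  (a-p2), Y2′ `stripArchCut_holds` (a-p5), Y3′ `stripELimZeroY_holds` (a-p5), S0′ `stripBlimPos_holds` (a-p5).
* `stripBy_bddAbove_of_lt` (T-A′) and `stripBy_not_bddAbove_of_gt` (T-B′), both unconditional.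
* The lane's strip threshold `stripYT T := sSup {y ≥ 0 : L ↦ B_{T,L}(x_c; y) bounded}` with the tokens `le_stripYT` / `stripYT_le`,
  `yStar_le_stripYT`, and the capstone **`tendsto_stripYT_yStar : Tendsto (fun T => stripYT (T + 1)) atTop (𝓝 yStar)`, UNCONDITIONAL**
  — the face UB′ `stripByUnboundedLarge_holds` (a-p2; zig-zag surface walks: for `y > 2 + √2` the class is unbounded for EVERY `T ≥ 1`)
  is what makes the `sSup` honest.

LABEL (lit-1 g11 (C), 2026-08-23): «BBdGDCG14 §4.2 + §4.5 core ⇒ lim_T y_T = 1 + √2 AT THE STRIP LEVEL; the identification of the lane's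
`y_T` with the printed `y_T` (Corollary 8: radius of `B_T(x_c; ·)`, `y_T ↓ y_c`) and with `y_c(κ)` (Prop. 5, eq. (4)) is NOT formalised
here» — no sentence of this file asserts «y_c = 1 + √2» about the half-plane surface free energy.
-/

noncomputable section

open Finset Filter Topology Real
open Literature.Probability.LatticeModels Literature.Probability.Percolation

namespace Literature.Probability.RandomPlanarGeometry.SAW.HV

-- Face Y3′ `StripELimZeroY` and `stripELimZeroY_holds` are a-p5 g7's `HexSAWStripELimZeroY.lean` (imported; no copy here).


/-- **TARGET Y-UPPER′** (BBdGDCG §4.5, `y_c ≤ y*`): for `y > y*` and all large `T` the `y`-weighted bridge class of `S_T` is unbounded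
in `L`.  Inputs: Y1′, Y2′, Y3′, the tree's `strip_identity_lim` (`cos(3π/8) A_T + B_T = 1`) and `B_T(x_c,1) → 0` (tree
`hexBridgeLogDecay : B_T ≤ 5 (ln T)^{-1/3}`); the threshold is explicit: any `T` with `cos(3π/8) x_c B_T(x_c,1) < |β(y)|`.
[cite: BeatonBousquetMelouDeGierDuminilCopinGuttmann2014, §4.5, eq. (20) (arXiv v5 p. 15) with Theorem 10 (p. 14)] -/
def StripByUnbounded : Prop :=
  ∀ y : ℝ, yStar < y → ∃ T₀ : ℕ, ∀ T ≥ T₀, ¬ BddAbove (Set.range fun L : ℕ => stripGFy T L (IsBetaDart T) y)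


/-- **R96′ CORE TARGET «HEX-YC-DCS-CORE»**. With the dictionary (HTW82 `μ(y)`, BBdGDCG Props 5–8: `y_c = lim_T y_T`) = Theorem 2 (arXiv v5 p. 3).
[cite: BeatonBousquetMelouDeGierDuminilCopinGuttmann2014, Theorem 2 (arXiv v5 p. 3) via §4.2 eq. (17) (p. 14) and §4.5 eq. (20) with Theorem 10 (pp. 14–15); strip-level core] -/
def HexYcDCSCore : Prop := StripByBound ∧ StripByUnbounded

/-- Y-LOWER′ from Y1′ (PROVED glue: all other terms of the identity are nonnegative).
[cite: BeatonBousquetMelouDeGierDuminilCopinGuttmann2014, §4.2 (arXiv v5 p. 14: boundedness of B_{T,L}(x_c; y) from the identity (16), the other terms being nonnegative); GlazmanManolescu2019, Corollary 2.5 (arXiv v3 p. 9: "Assume that y < 1+√2. Then B_T(Θ; y) ≤ √2y/(1+√2−y)")] -/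
theorem stripByBound_of_identity (h : StripIdentityY) : StripByBound := by
  intro T L y hT hy _
  have hid := h T L y hT hy
  have hx : 0 < hexCriticalFugacity := hexCriticalFugacity_pos_lt_one.1
  have hA : 0 ≤ stripGFy T L IsAlphaDart y := sum_nonneg fun P _ => by positivity
  have hE : 0 ≤ stripGFy T L (IsEpsDart L) y := sum_nonneg fun P _ => by positivity
  have hc1 : 0 ≤ Real.cos (3 * Real.pi / 8) :=
    Real.cos_nonneg_of_neg_pi_div_two_le_of_le (by linarith [Real.pi_pos]) (by linarith [Real.pi_pos])
  have hc2 : 0 ≤ Real.cos (Real.pi / 4) :=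
    Real.cos_nonneg_of_neg_pi_div_two_le_of_le (by linarith [Real.pi_pos]) (by linarith [Real.pi_pos])
  nlinarith [mul_nonneg hc1 hA, mul_nonneg hc2 hE]

/-- **Y-UPPER′ from the faces (PROVED glue = BBdGDCG §4.5 verbatim, finite form)**: for `y > y*` put `b = −β(y) > 0` and take
`T₀` with `cos(3π/8)·x_c·B_T(x_c,1) ≤ b/2` for `T ≥ T₀` (tree `HV.tendsto_stripBlim`); if `L ↦ B_{T+1,L}(y)` were bounded, Y3′ gives
`E_{T+1,L}(y) → 0`, while Y1′ (at `T+1, y`), Y2′, `A_{T,L}(1) ≤ A_T` and the tree's limit identity `cos(3π/8) A_T + B_T = 1` give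
`cos(π/4) E_{T+1,L}(y) ≥ B_T(x_c,1) > 0` for every `L`.
[cite: BeatonBousquetMelouDeGierDuminilCopinGuttmann2014, §4.5, eq. (20) ("By looking at its last contact, one can factor the arch into two bridges", arXiv v5 p. 15) with Theorem 10 (p. 14)] -/
theorem stripByUnbounded_of_faces (h1 : StripIdentityY) (h2 : StripArchCut) (h3 : StripELimZeroY) (h0 : StripBlimPos) :
    StripByUnbounded := by
  intro y hy
  have hx : 0 < hexCriticalFugacity := hexCriticalFugacity_pos_lt_one.1
  have hα : 0 < Real.cos (3 * Real.pi / 8) :=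
    Real.cos_pos_of_mem_Ioo ⟨by linarith [Real.pi_pos], by linarith [Real.pi_pos]⟩
  have hε : 0 < Real.cos (Real.pi / 4) :=
    Real.cos_pos_of_mem_Ioo ⟨by linarith [Real.pi_pos], by linarith [Real.pi_pos]⟩
  have hs2 : 0 < Real.sqrt 2 := by positivity
  have hy1 : 1 < y := by unfold yStar at hy; linarith
  have hy0 : 0 < y := by linarith
  -- `b = -β(y) > 0`
  have hb : 0 < -betaY y := by
    unfold betaY; unfold yStar at hy
    rw [neg_pos]
    exact div_neg_of_neg_of_pos (by linarith) (by positivity)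
  set b : ℝ := -betaY y with hbdef
  -- `B_T(1) → 0`: eventually `cos(3π/8) x_c B_T ≤ b/2`
  have hsmall : ∀ᶠ T : ℕ in atTop, stripBlim T < b / (2 * (Real.cos (3 * Real.pi / 8) * hexCriticalFugacity)) :=
    tendsto_stripBlim.eventually (gt_mem_nhds (by positivity))
  obtain ⟨T₀, hT₀⟩ := Filter.eventually_atTop.1 hsmall
  refine ⟨T₀ + 2, fun T' hT' hbdd => ?_⟩
  obtain ⟨T, rfl⟩ : ∃ T, T' = T + 1 := ⟨T' - 1, by omega⟩
  have hT : 1 ≤ T := by omega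
  have hBT : Real.cos (3 * Real.pi / 8) * hexCriticalFugacity * stripBlim T ≤ b / 2 := by
    have h := (hT₀ T (by omega)).le
    have hc : 0 < Real.cos (3 * Real.pi / 8) * hexCriticalFugacity := mul_pos hα hx
    calc Real.cos (3 * Real.pi / 8) * hexCriticalFugacity * stripBlim T
        ≤ Real.cos (3 * Real.pi / 8) * hexCriticalFugacity * (b / (2 * (Real.cos (3 * Real.pi / 8) * hexCriticalFugacity))) :=
          mul_le_mul_of_nonneg_left h hc.le
      _ = b / 2 := by field_simp
  obtain ⟨K, hK⟩ := hbdd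
  have hKL : ∀ L : ℕ, stripGFy (T + 1) L (IsBetaDart (T + 1)) y ≤ K := fun L => hK ⟨L, rfl⟩
  have hE := h3 (T + 1) y K (by omega) hy0 hKL
  -- the lower bound `B_T(1) ≤ cos(π/4) E_{T+1,L}(y)` for every `L`
  have hlow : ∀ L : ℕ, stripBlim T ≤ Real.cos (Real.pi / 4) * stripGFy (T + 1) L (IsEpsDart L) y := by
    intro L
    have hid := h1 (T + 1) L y (by omega) hy0
    have hcut := h2 T L y hT hy0
    have hAle := stripA_le_lim DuminilCopinSmirnov2012_lemma2_holds hT L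
    have hlim := strip_identity_lim hT
    have hB0 : 0 ≤ stripGFy (T + 1) L (IsBetaDart (T + 1)) y := sum_nonneg fun P _ => by positivity
    have hBT0 : 0 ≤ stripBlim T := stripBlim_nonneg hT
    have h4 : Real.cos (3 * Real.pi / 8) * hexCriticalFugacity * stripBlim T * stripGFy (T + 1) L (IsBetaDart (T + 1)) y ≤
        b / 2 * stripGFy (T + 1) L (IsBetaDart (T + 1)) y := mul_le_mul_of_nonneg_right hBT hB0
    have h5 := mul_le_mul_of_nonneg_left hcut hα.le
    have h6 := mul_le_mul_of_nonneg_left hAle hα.le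
    have h7 : betaY y = -b := by rw [hbdef, neg_neg]
    rw [h7] at hid
    nlinarith [mul_nonneg hb.le hB0]
  -- contradiction with `E → 0`
  have hpos : 0 < stripBlim T := h0 T hT
  have hev : ∀ᶠ L : ℕ in atTop, stripGFy (T + 1) L (IsEpsDart L) y < stripBlim T / Real.cos (Real.pi / 4) :=
    hE.eventually (gt_mem_nhds (by positivity))
  obtain ⟨L, hL⟩ := hev.exists
  have := hlow L
  have : Real.cos (Real.pi / 4) * stripGFy (T + 1) L (IsEpsDart L) y < stripBlim T := by
    calc Real.cos (Real.pi / 4) * stripGFy (T + 1) L (IsEpsDart L) y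
        < Real.cos (Real.pi / 4) * (stripBlim T / Real.cos (Real.pi / 4)) := mul_lt_mul_of_pos_left hL hε
      _ = stripBlim T := by field_simp
  linarith


/-- **Face Y2′ with an arbitrary cut constant** (`c = x_c` is the printed (20); `c = 2x_c` is a-p5's Y2″): the glue is insensitive.
[cite: BeatonBousquetMelouDeGierDuminilCopinGuttmann2014, §4.5, eq. (20) ("By looking at its last contact, one can factor the arch into two bridges", arXiv v5 p. 15) with Theorem 10 (p. 14); with a constant c in place of x_c — lane variant] -/
def StripArchCutC (c : ℝ) : Prop :=
  ∀ (T L : ℕ) (y : ℝ), 1 ≤ T → 0 < y →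
    stripGFy (T + 1) L IsAlphaDart y - stripA T L hexCriticalFugacity ≤
      c * stripGFy (T + 1) L (IsBetaDart (T + 1)) y * stripBlim T

/-- The printed cut (20) is the case `c = x_c`. [cite: BeatonBousquetMelouDeGierDuminilCopinGuttmann2014, §4.5, eq. (20) ("By looking at its last contact, one can factor the arch into two bridges", arXiv v5 p. 15) with Theorem 10 (p. 14)] -/
theorem stripArchCutC_of_stripArchCut (h : StripArchCut) : StripArchCutC hexCriticalFugacity :=
  fun T L y hT hy => h T L y hT hy

/-- The glue for any positive cut constant `c` (threshold: `c·cos(3π/8)·B_T(x_c,1) ≤ −β(y)/2`).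
[cite: BeatonBousquetMelouDeGierDuminilCopinGuttmann2014, §4.5, eq. (20) ("By looking at its last contact, one can factor the arch into two bridges", arXiv v5 p. 15) with Theorem 10 (p. 14)] -/
theorem stripByUnbounded_of_faces_c {c : ℝ} (hc : 0 < c) (h1 : StripIdentityY) (h2 : StripArchCutC c)
    (h3 : StripELimZeroY) (h0 : StripBlimPos) : StripByUnbounded := by
  intro y hy
  have hx : 0 < hexCriticalFugacity := hexCriticalFugacity_pos_lt_one.1
  have hα : 0 < Real.cos (3 * Real.pi / 8) :=
    Real.cos_pos_of_mem_Ioo ⟨by linarith [Real.pi_pos], by linarith [Real.pi_pos]⟩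
  have hε : 0 < Real.cos (Real.pi / 4) :=
    Real.cos_pos_of_mem_Ioo ⟨by linarith [Real.pi_pos], by linarith [Real.pi_pos]⟩
  have hs2 : 0 < Real.sqrt 2 := by positivity
  have hy1 : 1 < y := by unfold yStar at hy; linarith
  have hy0 : 0 < y := by linarith
  have hb : 0 < -betaY y := by
    unfold betaY; unfold yStar at hy
    rw [neg_pos]
    exact div_neg_of_neg_of_pos (by linarith) (by positivity)
  set b : ℝ := -betaY y with hbdef
  have hsmall : ∀ᶠ T : ℕ in atTop, stripBlim T < b / (2 * (Real.cos (3 * Real.pi / 8) * c)) :=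
    tendsto_stripBlim.eventually (gt_mem_nhds (by positivity))
  obtain ⟨T₀, hT₀⟩ := Filter.eventually_atTop.1 hsmall
  refine ⟨T₀ + 2, fun T' hT' hbdd => ?_⟩
  obtain ⟨T, rfl⟩ : ∃ T, T' = T + 1 := ⟨T' - 1, by omega⟩
  have hT : 1 ≤ T := by omega
  have hBT : Real.cos (3 * Real.pi / 8) * c * stripBlim T ≤ b / 2 := by
    have h := (hT₀ T (by omega)).le
    have hc' : 0 < Real.cos (3 * Real.pi / 8) * c := mul_pos hα hc
    calc Real.cos (3 * Real.pi / 8) * c * stripBlim T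
        ≤ Real.cos (3 * Real.pi / 8) * c * (b / (2 * (Real.cos (3 * Real.pi / 8) * c))) :=
          mul_le_mul_of_nonneg_left h hc'.le
      _ = b / 2 := by field_simp
  obtain ⟨K, hK⟩ := hbdd
  have hKL : ∀ L : ℕ, stripGFy (T + 1) L (IsBetaDart (T + 1)) y ≤ K := fun L => hK ⟨L, rfl⟩
  have hE := h3 (T + 1) y K (by omega) hy0 hKL
  have hlow : ∀ L : ℕ, stripBlim T ≤ Real.cos (Real.pi / 4) * stripGFy (T + 1) L (IsEpsDart L) y := by
    intro L
    have hid := h1 (T + 1) L y (by omega) hy0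
    have hcut := h2 T L y hT hy0
    have hAle := stripA_le_lim DuminilCopinSmirnov2012_lemma2_holds hT L
    have hlim := strip_identity_lim hT
    have hB0 : 0 ≤ stripGFy (T + 1) L (IsBetaDart (T + 1)) y := sum_nonneg fun P _ => by positivity
    have hBT0 : 0 ≤ stripBlim T := stripBlim_nonneg hT
    have h4 : Real.cos (3 * Real.pi / 8) * c * stripBlim T * stripGFy (T + 1) L (IsBetaDart (T + 1)) y ≤
        b / 2 * stripGFy (T + 1) L (IsBetaDart (T + 1)) y := mul_le_mul_of_nonneg_right hBT hB0
    have h5 := mul_le_mul_of_nonneg_left hcut hα.le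
    have h6 := mul_le_mul_of_nonneg_left hAle hα.le
    have h7 : betaY y = -b := by rw [hbdef, neg_neg]
    rw [h7] at hid
    nlinarith [mul_nonneg hb.le hB0]
  have hpos : 0 < stripBlim T := h0 T hT
  have hev : ∀ᶠ L : ℕ in atTop, stripGFy (T + 1) L (IsEpsDart L) y < stripBlim T / Real.cos (Real.pi / 4) :=
    hE.eventually (gt_mem_nhds (by positivity))
  obtain ⟨L, hL⟩ := hev.exists
  have := hlow L
  have : Real.cos (Real.pi / 4) * stripGFy (T + 1) L (IsEpsDart L) y < stripBlim T := by
    calc Real.cos (Real.pi / 4) * stripGFy (T + 1) L (IsEpsDart L) y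
        < Real.cos (Real.pi / 4) * (stripBlim T / Real.cos (Real.pi / 4)) := mul_lt_mul_of_pos_left hL hε
      _ = stripBlim T := by field_simp
  linarith

/-- The door's deciding implication by name: the three faces, the XS support, and the tree give the core.
[cite: BeatonBousquetMelouDeGierDuminilCopinGuttmann2014, Theorem 2 (arXiv v5 p. 3) via §4.2 eq. (17) (p. 14) and §4.5 eq. (20) with Theorem 10 (pp. 14–15); strip-level core] -/
theorem hexYcDCSCore_of_faces (h1 : StripIdentityY) (h2 : StripArchCut) (h3 : StripELimZeroY) (h0 : StripBlimPos) :
    HexYcDCSCore :=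
  ⟨stripByBound_of_identity h1, stripByUnbounded_of_faces h1 h2 h3 h0⟩


/-! ## The strip thresholds `y_T` (LANE DEFINITION) and the capstone limits `y_T → y*` / `y_H → y†`

Printed (BBdGDCG14 Corollary 8, v5 p. 12; Beaton14 Corollary 10, v3 p. 15): `ρ_T(y) := 1/μ_{T−1}(1,y)` is the common radius (in `x`) of
`A_T, B_T, C_T(x; y)`; `y_T` is the unique `y` with `ρ_T(y_T) = x_c`; «the series (in y) `B_T(x_c; y)` have radius of convergence `y_T`, and
`y_T` decreases to the critical fugacity `y_c` as `T` goes to infinity», `y_c` being defined through the half-plane surface free energy `κ(y)`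
(Prop. 5 / Prop. 7, HTW 1982).  LANE DEFINITION used here (label it so): `y_T := sup {y ≥ 0 : L ↦ B_{T,L}(x_c, y) is bounded}` — the
boundedness threshold of the critical bridge class in the width; it coincides with the printed `y_T` by Cor. 8's third sentence, whose proof
(y-weighted HTW unfolding, Props 7–8) is NOT formalised here: the capstones below are «BBdGDCG14 §4.2 + §4.5 core ⇒ lim_T y_T = y*» and
«Beaton14 §4 core ⇒ lim_H y_H = y†» at the strip level; the identification `lim y_T = y_c(κ)` is the separate Cor. 8 / Cor. 10 door.
[cite: BeatonBousquetMelouDeGierDuminilCopinGuttmann2014, Proposition 5 (arXiv v5 p. 9); Corollary 8 (p. 12)]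
[cite: Beaton2014RotatedHoneycomb, Proposition 7 (arXiv v3 p. 11); Corollary 10 (p. 15); Theorem 1 (p. 2)] -/

/-- `0 < y*`. [cite: BeatonBousquetMelouDeGierDuminilCopinGuttmann2014, Theorem 10 (arXiv v5 p. 14: y*, the zero of the top-boundary coefficient) and §4.2, eq. (17) (p. 14)] -/
theorem yStar_pos : 0 < yStar := by unfold yStar; positivity

/-- Monotonicity in `y` of the `y`-weighted classes (polynomials in `y` with nonnegative coefficients).
[cite: BeatonBousquetMelouDeGierDuminilCopinGuttmann2014, §3.2 (arXiv v5 p. 12: A_T(x;y), B_T(x;y), C_T(x;y) are series in y with nonnegative coefficients; v1 §4.2 "their values increase")] -/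
theorem stripGFy_mono (T L : ℕ) (cls : HV × HV → Prop) [DecidablePred cls] {y y' : ℝ} (hy : 0 ≤ y) (hyy' : y ≤ y') :
    stripGFy T L cls y ≤ stripGFy T L cls y' := by
  have hx : 0 < hexCriticalFugacity := hexCriticalFugacity_pos_lt_one.1
  unfold stripGFy
  exact sum_le_sum fun P _ => mul_le_mul_of_nonneg_left (pow_le_pow_left₀ hy hyy' _) (pow_nonneg hx.le _)


/-- The set of fugacities at which the critical bridge class of `S_T` stays bounded in the width, and the lane's `y_T`.
[cite: BeatonBousquetMelouDeGierDuminilCopinGuttmann2014, Corollary 8 (arXiv v5 p. 12: "The series (in y) A_T(x_c;y), B_T(x_c;y) and C_T(x_c;y) have radius of convergence y_T, and y_T decreases to the critical fugacity y_c"); GlazmanManolescu2019, Proposition 1.2 (arXiv v3 p. 6: "y_c(T,Θ) is equal to the radius of convergence of B_{T,Θ}(1;y), and y_c(T,Θ) → y_c = 1+√2")] -/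
def stripBddSet (T : ℕ) : Set ℝ := {y : ℝ | 0 ≤ y ∧ BddAbove (Set.range fun L : ℕ => stripGFy T L (IsBetaDart T) y)}

/-- **`y_T` (LANE DEFINITION, DCS frame)**: `sup {y ≥ 0 : sup_L B_{T,L}(x_c,y) < ∞}`.  READING: `stripYT T` IS BBdGDCG14's `y_T` by Corollary 8
(sup of the boundedness set = radius in `y` of `B_T(x_c; ·)`, nonnegative coefficients) = GM20's `y_c(T, π/3)` by Prop. 1.2; not formalised: `ρ_T(y_T) = x_c`
and the monotonicity in `T`.
[cite: BeatonBousquetMelouDeGierDuminilCopinGuttmann2014, Corollary 8 (arXiv v5 p. 12: "The series (in y) A_T(x_c;y), B_T(x_c;y) and C_T(x_c;y) have radius of convergence y_T, and y_T decreases to the critical fugacity y_c"); GlazmanManolescu2019, Proposition 1.2 (arXiv v3 p. 6: "y_c(T,Θ) is equal to the radius of convergence of B_{T,Θ}(1;y), and y_c(T,Θ) → y_c = 1+√2")] -/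
def stripYT (T : ℕ) : ℝ := sSup (stripBddSet T)

-- Face UB′ `StripByUnboundedLarge` and `stripByUnboundedLarge_holds` are a-p2 g7's `HexSAWStripSurfaceZigzag.lean` (imported; no copy here).

/-- The boundedness set lies below `2 + √2` (face UB′, a-p2's `stripByUnboundedLarge_holds`). [cite: BeatonBousquetMelouDeGierDuminilCopinGuttmann2014, Corollary 8 (arXiv v5 p. 12: "The series (in y) A_T(x_c;y), B_T(x_c;y) and C_T(x_c;y) have radius of convergence y_T, and y_T decreases to the critical fugacity y_c"); GlazmanManolescu2019, Proposition 1.2 (arXiv v3 p. 6: "y_c(T,Θ) is equal to the radius of convergence of B_{T,Θ}(1;y), and y_c(T,Θ) → y_c = 1+√2")] -/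
theorem stripBddSet_le {T : ℕ} (hT : 1 ≤ T) {y : ℝ} (hy : y ∈ stripBddSet T) : y ≤ 2 + Real.sqrt 2 :=
  not_lt.1 fun h => stripByUnboundedLarge_holds T y hT h hy.2

/-- The boundedness set is bounded above (so `y_T = sSup` is a genuine supremum). [cite: BeatonBousquetMelouDeGierDuminilCopinGuttmann2014, Corollary 8 (arXiv v5 p. 12: "The series (in y) A_T(x_c;y), B_T(x_c;y) and C_T(x_c;y) have radius of convergence y_T, and y_T decreases to the critical fugacity y_c"); GlazmanManolescu2019, Proposition 1.2 (arXiv v3 p. 6: "y_c(T,Θ) is equal to the radius of convergence of B_{T,Θ}(1;y), and y_c(T,Θ) → y_c = 1+√2")] -/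
theorem stripBddSet_bddAbove {T : ℕ} (hT : 1 ≤ T) : BddAbove (stripBddSet T) :=
  ⟨2 + Real.sqrt 2, fun _ hy => stripBddSet_le hT hy⟩

/-- «`B_T(x_c, y)` finite ⇒ `y ≤ y_T`». [cite: BeatonBousquetMelouDeGierDuminilCopinGuttmann2014, Corollary 8 (arXiv v5 p. 12: "The series (in y) A_T(x_c;y), B_T(x_c;y) and C_T(x_c;y) have radius of convergence y_T, and y_T decreases to the critical fugacity y_c"); GlazmanManolescu2019, Proposition 1.2 (arXiv v3 p. 6: "y_c(T,Θ) is equal to the radius of convergence of B_{T,Θ}(1;y), and y_c(T,Θ) → y_c = 1+√2")] -/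
theorem le_stripYT {T : ℕ} (hT : 1 ≤ T) {y : ℝ} (hy : 0 ≤ y)
    (hb : BddAbove (Set.range fun L : ℕ => stripGFy T L (IsBetaDart T) y)) : y ≤ stripYT T :=
  le_csSup (stripBddSet_bddAbove hT) ⟨hy, hb⟩

/-- «`B_T(x_c, y)` infinite ⇒ `y_T ≤ y`» (monotonicity in `y`). [cite: BeatonBousquetMelouDeGierDuminilCopinGuttmann2014, Corollary 8 (arXiv v5 p. 12: "The series (in y) A_T(x_c;y), B_T(x_c;y) and C_T(x_c;y) have radius of convergence y_T, and y_T decreases to the critical fugacity y_c"); GlazmanManolescu2019, Proposition 1.2 (arXiv v3 p. 6: "y_c(T,Θ) is equal to the radius of convergence of B_{T,Θ}(1;y), and y_c(T,Θ) → y_c = 1+√2")] -/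
theorem stripYT_le {T : ℕ} (hne : (stripBddSet T).Nonempty) {y : ℝ} (hy : 0 ≤ y)
    (hnb : ¬ BddAbove (Set.range fun L : ℕ => stripGFy T L (IsBetaDart T) y)) : stripYT T ≤ y := by
  refine csSup_le hne fun y' hy' => ?_
  by_contra h
  push Not at h
  obtain ⟨K, hK⟩ := hy'.2
  exact hnb ⟨K, by
    rintro _ ⟨L, rfl⟩
    exact (stripGFy_mono T L (IsBetaDart T) hy h.le).trans (hK ⟨L, rfl⟩)⟩

/-- Below `y*` the class is bounded (core, lower half), so `(0, y*) ⊆ stripBddSet T`. [cite: BeatonBousquetMelouDeGierDuminilCopinGuttmann2014, Corollary 8 (arXiv v5 p. 12: "The series (in y) A_T(x_c;y), B_T(x_c;y) and C_T(x_c;y) have radius of convergence y_T, and y_T decreases to the critical fugacity y_c"); GlazmanManolescu2019, Proposition 1.2 (arXiv v3 p. 6: "y_c(T,Θ) is equal to the radius of convergence of B_{T,Θ}(1;y), and y_c(T,Θ) → y_c = 1+√2")] -/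
theorem mem_stripBddSet_of_lt {T : ℕ} (hT : 1 ≤ T) {y : ℝ} (hy : 0 < y) (hyS : y < yStar) :
    y ∈ stripBddSet T := by
  have hs2 : 0 < Real.sqrt 2 := by positivity
  have hβ : 0 < betaY y := by
    unfold betaY; unfold yStar at hyS
    exact div_pos (by linarith) (by positivity)
  refine ⟨hy.le, ⟨1 / betaY y, ?_⟩⟩
  rintro _ ⟨L, rfl⟩
  have h := stripByBound_holds T L y hT hy hyS
  rw [le_div_iff₀ hβ, mul_comm]
  exact h

/-- **`y* ≤ y_T`** (the desorbed half at strip level). [cite: BeatonBousquetMelouDeGierDuminilCopinGuttmann2014, §4.2, eq. (17) (arXiv v5 p. 14: B_T(x_c; y) stays bounded for y < y*, whence y* ≤ y_T); Corollary 8 (p. 12)] -/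
theorem yStar_le_stripYT {T : ℕ} (hT : 1 ≤ T) : yStar ≤ stripYT T := by
  refine le_of_not_gt fun hlt => ?_
  set c : ℝ := (max (stripYT T) 0 + yStar) / 2 with hc
  have hmax : max (stripYT T) 0 < yStar := max_lt hlt yStar_pos
  have hc0 : 0 < c := by rw [hc]; linarith [le_max_right (stripYT T) 0]
  have hcS : c < yStar := by rw [hc]; linarith
  have hcY : stripYT T < c := by rw [hc]; linarith [le_max_left (stripYT T) 0]
  have hmem := mem_stripBddSet_of_lt hT hc0 hcS
  exact absurd (le_stripYT hT hc0.le hmem.2) (not_le.2 hcY)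

/-! ## The door closed by name (Y1′ a-p2 K97.1 ed.2; Y2′, S0′, Y3′ a-p5; UB′ a-p2) — everything below is UNCONDITIONAL -/

/-- **R96′ core «HEX-YC-DCS»: both halves of BBdGDCG Theorem 2 at the strip level, UNCONDITIONAL.**
[cite: BeatonBousquetMelouDeGierDuminilCopinGuttmann2014, §4.2 eq. (17) and §4.5 eq. (20) with Theorem 10 (arXiv v5 pp. 14–15)] -/
theorem hexYcDCSCore_holds : HexYcDCSCore :=
  hexYcDCSCore_of_faces stripIdentityY_holds stripArchCut_holds stripELimZeroY_holds stripBlimPos_holds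

/-- `HexYcDCSCore` — `_holds` alias of `hexYcDCSCore_holds` above under the fact's exact name (appended
2026-08-28, D-0026 bookkeeping: the proof term is the existing theorem of this file; no statement,
definition or attribute is edited; no new named fact; the ledger's debt table listed the fact
unproved). [cite: BeatonBousquetMelouDeGierDuminilCopinGuttmann2014, §4.2 eq. (17) and §4.5 eq. (20) with Theorem 10 (arXiv v5 pp. 14–15)] -/
theorem _root_.Literature.Probability.RandomPlanarGeometry.SAW.HV.HexYcDCSCore_holds :
    HexYcDCSCore :=
  _root_.Literature.Probability.RandomPlanarGeometry.SAW.HV.hexYcDCSCore_holds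

/-- **Target Y-UPPER′ holds** (the named face `StripByUnbounded` discharged: the second half of the core).
[cite: BeatonBousquetMelouDeGierDuminilCopinGuttmann2014, §4.5, eq. (20) (arXiv v5 p. 15) with Theorem 10 (p. 14)] -/
theorem stripByUnbounded_holds : StripByUnbounded := hexYcDCSCore_holds.2

/-- `StripByUnbounded` — `_holds` alias of `stripByUnbounded_holds` above under the fact's exact name (appended
2026-08-28, D-0026 bookkeeping: the proof term is the existing theorem of this file; no statement,
definition or attribute is edited; no new named fact; the ledger's debt table listed the fact
unproved). [cite: BeatonBousquetMelouDeGierDuminilCopinGuttmann2014, §4.5, eq. (20) (arXiv v5 p. 15) with Theorem 10 (p. 14)] -/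
theorem _root_.Literature.Probability.RandomPlanarGeometry.SAW.HV.StripByUnbounded_holds :
    StripByUnbounded :=
  _root_.Literature.Probability.RandomPlanarGeometry.SAW.HV.stripByUnbounded_holds

/-- **T-A′ (the `y_c ≥ 1 + √2` half at strip level, §4.2)**: for `0 < y < 1 + √2` and every `T ≥ 1` the critical `y`-weighted bridge
class of `S_T` is bounded in the width. [cite: BeatonBousquetMelouDeGierDuminilCopinGuttmann2014, §4.2 eq. (17) (arXiv v5 p. 14)] -/
theorem stripBy_bddAbove_of_lt {T : ℕ} (hT : 1 ≤ T) {y : ℝ} (hy : 0 < y) (hlt : y < 1 + Real.sqrt 2) :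
    BddAbove (Set.range fun L : ℕ => stripGFy T L (IsBetaDart T) y) :=
  (mem_stripBddSet_of_lt hT hy (by unfold yStar; exact hlt)).2

/-- **T-B′ (the `y_c ≤ 1 + √2` half at strip level, §4.5)**: for `y > 1 + √2` and all large `T` the class is unbounded in the width.
[cite: BeatonBousquetMelouDeGierDuminilCopinGuttmann2014, §4.5 eq. (20) with Theorem 10 (arXiv v5 pp. 14–15)] -/
theorem stripBy_not_bddAbove_of_gt {y : ℝ} (hy : 1 + Real.sqrt 2 < y) :
    ∃ T₀ : ℕ, ∀ T ≥ T₀, ¬ BddAbove (Set.range fun L : ℕ => stripGFy T L (IsBetaDart T) y) :=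
  hexYcDCSCore_holds.2 y (by unfold yStar; exact hy)

/-- For `y > y*` and `T` large, `y_{T+1} ≤ y`. [cite: BeatonBousquetMelouDeGierDuminilCopinGuttmann2014, §4.5 («y_T < y», arXiv v5 p. 15)] -/
theorem stripYT_le_of_gt {y : ℝ} (hy : yStar < y) : ∀ᶠ T : ℕ in atTop, stripYT (T + 1) ≤ y := by
  obtain ⟨T₀, hT₀⟩ := hexYcDCSCore_holds.2 y hy
  refine eventually_atTop.2 ⟨T₀, fun T hT => ?_⟩
  have hne : (stripBddSet (T + 1)).Nonempty :=
    ⟨1, mem_stripBddSet_of_lt (by omega) one_pos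
      (by unfold yStar; have : 0 < Real.sqrt 2 := by positivity
          linarith)⟩
  exact stripYT_le hne (yStar_pos.trans hy).le (hT₀ (T + 1) (by omega))

/-- **CAPSTONE (DCS frame, strip level), UNCONDITIONAL: `y_{T+1} → y* = 1 + √2`.**
[cite: BeatonBousquetMelouDeGierDuminilCopinGuttmann2014, Theorem 2 with Corollary 8 (arXiv v5 pp. 3, 12); strip-level core only] -/
theorem tendsto_stripYT_yStar : Tendsto (fun T : ℕ => stripYT (T + 1)) atTop (𝓝 yStar) := by
  rw [tendsto_order]
  refine ⟨fun a ha => Eventually.of_forall fun T => lt_of_lt_of_le ha (yStar_le_stripYT (by omega)), fun b hb => ?_⟩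
  obtain ⟨y, hy1, hy2⟩ := exists_between hb
  exact (stripYT_le_of_gt hy1).mono fun T hT => lt_of_le_of_lt hT hy2

end Literature.Probability.RandomPlanarGeometry.SAW.HV
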